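import Literature.NumberTheory.Automorphic.ReciprocityGLn
import Literature.NumberTheory.LFunctions.RHWave0HasseProofs
import HarnessLib

/-!
# Global reciprocity for `GL_n`: the Hasse bound for the trace of Frobenius (proofs file)

Sibling proofs file (D-0014) of `Literature/NumberTheory/Automorphic/ReciprocityGLn.lean`
(statements **lang.S27**, **lang.S03**, **lang.S28** of the family `lang`). It holds the one
declaration of that module which consumes the RH-family inventory file
`Literature/NumberTheory/LFunctions/RHWave0.lean`: the **Hasse bound** `|a_v(E)| ≤ 2 √q_v` for
the trace of Frobenius `a_v(E) = q_v + 1 - #E(k_v)` (`Literature.NumberTheory.Automorphic.frobTraceAt`)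
of an integral Weierstrass model `E` over `𝓞 K` at a finite place `v ∤ Δ(E)` (good reduction of
the model), `Literature.NumberTheory.Automorphic.abs_frobTraceAt_le`, deduced from the named fact
`Literature.NumberTheory.LFunctions.hasse_bound` (inventory id rh.S36: `|#W(𝔽_q) - q - 1| ≤ 2 √q`
for every elliptic curve over a finite field; no further copy of Hasse's theorem is stated here),
together with its **unconditional** form `Literature.NumberTheory.Automorphic.abs_frobTraceAt_le'`
through the discharge `Literature.NumberTheory.LFunctions.hasse_bound_holds` of
`RHWave0HasseProofs` (Manin's elementary proof, vendored and proved in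
`Literature.NumberTheory.EllipticCurves.HasseManin`).

Librarian refactor 2026-08-15 (work item wi-06490, cone hygiene for the summit `Langlands`):
`ReciprocityGLn.lean` is imported by `Summits/Langlands/Langlands/Statement.lean`; since that
refactor it no longer imports `LFunctions.RHWave0` (its module docstring, "M5 migration note",
announces that the Hasse bound lives here), so that the RH-family statements stay out of the
import cone of the summit. The present file restores the moved theorem with the statement it had
in `ReciprocityGLn` (hypothesis `h : hasse_bound`, good reduction as `E.Δ ∉ v.asIdeal`) and is
imported by nothing.

* `isElliptic_map_of_Δ_not_mem` : `v ∤ Δ(E)` ⟹ the reduction `E mod v` is an elliptic curve over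
  `k_v = 𝓞 K ⧸ v`;
* `abs_frobTraceAt_le (h : hasse_bound) E v (hv : E.Δ ∉ v.asIdeal) : |a_v(E)| ≤ 2 √q_v`;
* `abs_frobTraceAt_le' E v hv : |a_v(E)| ≤ 2 √q_v` (unconditional, via `hasse_bound_holds`).

Design: `k_v` is Mathlib's quotient `𝓞 K ⧸ v.asIdeal` (a finite field: instances
`IsDedekindDomain.HeightOneSpectrum.isMaximal`, `Finite (𝓞 K ⧸ I)` for maximal `I` of
`Mathlib/NumberTheory/NumberField/Ideal/Basic`, and the non-instance `Ideal.Quotient.field`, used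
locally in the proofs only); `q_v = v.residueCard = Ideal.absNorm v.asIdeal = #(𝓞 K ⧸ v)`
(`IsDedekindDomain.HeightOneSpectrum.residueCard_eq_card_quotient`, G09). Nothing here is new
mathematics; deliberately NOT here: the identification of `a_v(E)` with the trace of Frobenius
on the Tate module (Silverman V Thm. 2.3.1), which `ReciprocityGLn` only uses through
`frobPoly`.

## References

* J. H. Silverman, *The Arithmetic of Elliptic Curves*, 2nd ed., GTM 106, Springer 2009:
  Thm. V.1.1 (Hasse), VII §2 and Prop. VII.5.1 (reduction modulo `v`, good reduction iff
  `v(Δ) = 0` for a minimal model). [SilvermanAEC2009]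
* H. Hasse, *Zur Theorie der abstrakten elliptischen Funktionenkörper I–III*, J. reine angew.
  Math. 175 (1936).
-/

noncomputable section

open NumberField IsDedekindDomain

namespace Literature.NumberTheory.Automorphic

universe u

variable {K : Type u} [Field K] [NumberField K]

/-- **Good reduction of the model.** If the finite place `v` does not contain the discriminant
`Δ(E)` of the integral Weierstrass model `E` over `𝓞 K`, then the reduction of `E` modulo `v`
(Mathlib `WeierstrassCurve.map` along `𝓞 K → 𝓞 K ⧸ v = k_v`) is an elliptic curve over the
residue field `k_v`: its discriminant is the image of `Δ(E)`, a non-zero element of the field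
`k_v`, hence a unit. Silverman, *AEC* VII §2 and Prop. VII.5.1(a).
[cite: SilvermanAEC2009, Prop. VII.5.1(a)] -/
theorem isElliptic_map_of_Δ_not_mem (E : WeierstrassCurve (𝓞 K)) (v : HeightOneSpectrum (𝓞 K))
    (hv : E.Δ ∉ v.asIdeal) : (E.map (Ideal.Quotient.mk v.asIdeal)).IsElliptic := by
  letI := Ideal.Quotient.field v.asIdeal
  have hne : Ideal.Quotient.mk v.asIdeal E.Δ ≠ 0 := mt Ideal.Quotient.eq_zero_iff_mem.1 hv
  exact ⟨by simpa only [WeierstrassCurve.map_Δ] using hne.isUnit⟩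

/-- **Hasse bound for the trace of Frobenius of an integral model** (Hasse 1936; Silverman,
*AEC* Thm. V.1.1): if `v ∤ Δ(E)` (good reduction of the integral Weierstrass model `E` over
`𝓞 K` at the finite place `v`), then `|a_v(E)| ≤ 2 √q_v`, where
`a_v(E) = q_v + 1 - #E(k_v) = frobTraceAt E v` and `q_v = v.residueCard = #k_v`. Deduced from the
named fact `Literature.NumberTheory.LFunctions.hasse_bound` (rh.S36) applied to the elliptic curve
`E mod v` over the finite field `k_v = 𝓞 K ⧸ v` (`isElliptic_map_of_Δ_not_mem`). This is the
theorem moved out of `ReciprocityGLn.lean` by the librarian refactor of 2026-08-15 (same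
statement). [cite: SilvermanAEC2009, Thm. V.1.1] -/
theorem abs_frobTraceAt_le (h : Literature.NumberTheory.LFunctions.hasse_bound.{u})
    (E : WeierstrassCurve (𝓞 K)) (v : HeightOneSpectrum (𝓞 K)) (hv : E.Δ ∉ v.asIdeal) :
    |(frobTraceAt E v : ℝ)| ≤ 2 * Real.sqrt v.residueCard := by
  letI := Ideal.Quotient.field v.asIdeal
  letI : Fintype (𝓞 K ⧸ v.asIdeal) := Fintype.ofFinite _
  haveI := isElliptic_map_of_Δ_not_mem E v hv
  have hq : (v.residueCard : ℝ) = (Fintype.card (𝓞 K ⧸ v.asIdeal) : ℝ) := by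
    rw [HeightOneSpectrum.residueCard_eq_card_quotient, Nat.card_eq_fintype_card]
  have hH : |(numPointsResidue E v : ℝ) - (v.residueCard + 1)| ≤ 2 * Real.sqrt v.residueCard := by
    rw [hq]
    exact h (E.map (Ideal.Quotient.mk v.asIdeal))
  have hcast : (frobTraceAt E v : ℝ) = (v.residueCard : ℝ) + 1 - numPointsResidue E v := by
    simp [frobTraceAt]
  rw [hcast, ← abs_sub_comm]
  exact hH

/-- **Hasse bound for the trace of Frobenius of an integral model, unconditionally**: for an
integral Weierstrass model `E` over `𝓞 K` and a finite place `v ∤ Δ(E)`,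
`|a_v(E)| ≤ 2 √q_v` — `abs_frobTraceAt_le` fed with the discharge
`Literature.NumberTheory.LFunctions.hasse_bound_holds` (Manin's elementary proof of Hasse's
theorem, `Literature.NumberTheory.EllipticCurves.HasseManin.abs_card_sub_le`).
[cite: SilvermanAEC2009, Thm. V.1.1] -/
theorem abs_frobTraceAt_le' (E : WeierstrassCurve (𝓞 K)) (v : HeightOneSpectrum (𝓞 K))
    (hv : E.Δ ∉ v.asIdeal) : |(frobTraceAt E v : ℝ)| ≤ 2 * Real.sqrt v.residueCard :=
  abs_frobTraceAt_le LFunctions.hasse_bound_holds.{u} E v hv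

end Literature.NumberTheory.Automorphic

end
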